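import Summits.BirchSwinnertonDyer.BirchSwinnertonDyer.Theorems.ResidualThetaTransportAtTwoResidualThetaCountLowerPureAtTwoOfLambdaLower
import HarnessLib

/-!
# FRAME skeleton for the crux `(R≥)ᵖ` `ResidualThetaCountLowerPureAtTwo` (stmt-BirchSwinnertonDyer-26074) — lead rtt-p2 g10
# (NOT a line and NOT registered: a lever-neutral frame for the crux-plan seats; every filed card refines `stub_lambdaLowerPure`)

Three stubs, composition BY NAME through the landed `ResidualLayer.residualThetaCountLowerPureAtTwo_of_lambdaLowerPure` (p618059):
* `stub_publishedInputsGreenbergControlAtTwo` := route item PUB-G (stmt-BirchSwinnertonDyer-24143) BY NAME (print binder of `closes`);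
* `stub_rankEqAnalyticRankLeOne` := route item GZK (stmt-BirchSwinnertonDyer-19921) BY NAME (print binder of `closes`);
* `stub_lambdaLowerPure` := `(Λ≥)ᵖ`, the `ncard`-free λ-inequality with EXACTLY the item's binders (memo `LAMBDA-INEQ-g10.md` §2).
`lean check`: rc 0, sorries 3 (the stubs), `ResidualThetaCountLowerPureAtTwo_of` concludes the crux by name. BSD is not proved by this.
-/

set_option autoImplicit false
set_option linter.dupNamespace false

namespace Summit.BirchSwinnertonDyer.BirchSwinnertonDyer.Cruxes.ResidualThetaCountLowerPureAtTwo.LambdaIneqFrame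

/-- Stub (by name): the route's print binder PUB-G, item stmt-BirchSwinnertonDyer-24143. -/
theorem stub_publishedInputsGreenbergControlAtTwo : Summit.BirchSwinnertonDyer.BirchSwinnertonDyer.Theses.ResidualThetaTransportAtTwo.PublishedInputsGreenbergControlAtTwo := by
  sorry

/-- Stub (by name): the route's print binder GZK, item stmt-BirchSwinnertonDyer-19921. -/
theorem stub_rankEqAnalyticRankLeOne : Summit.BirchSwinnertonDyer.BirchSwinnertonDyer.Theses.ResidualThetaTransportAtTwo.RankEqAnalyticRankLeOne := by
  sorry

/-- Stub `(Λ≥)ᵖ` — the research content of the crux: for the item's data,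
`d + Σ_g(S₀) ≤ lambdaInvariant 2 D.X + Σ_W(S₀)` (no `H¹`, no set, no `ncard`). Every filed lever (C1 GL₁ plus Selmer + JLK,
character-side transport, Kato-defect transport, Kolyvagin rigidity, Teichmüller line switch) is a proof plan for THIS statement:
(λT) `λ(D.X) + Σ_W(S₀) = Λ_{S₀}(CM-side object)` along `W[2] ≅ ρ̄_g` + (MC≥) on the CM side. -/
theorem stub_lambdaLowerPure : ∀ (W : WeierstrassCurve ℚ) [W.IsElliptic] [W.IsGloballyMinimal], ¬ W.HasCM → W.analyticRank = 0 → Literature.NumberTheory.EllipticCurves.Rank1Residual.GoodSS W 2 → W.frobeniusTrace 2 = 0 → W.Δ < 0 → ∀ (M : ℕ) [NeZero M] (g : CuspForm (CongruenceSubgroup.Gamma0 M) 2) (ι : Literature.NumberTheory.EllipticCurves.ModularForms.coeffField g →+* PadicAlgCl 2) (Ω : ℂ), Odd M → Literature.NumberTheory.EllipticCurves.ModularForms.IsNewform0 g → Literature.NumberTheory.Automorphic.IsCMForm (Literature.NumberTheory.EllipticCurves.ModularForms.liftToGamma1 M 2 g) → Literature.NumberTheory.EllipticCurves.ModularForms.cuspCoeff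 g 2 = 0 → Literature.NumberTheory.EllipticCurves.IsCohomologicalPlusPeriod g ι Ω → (∀ ℓ : ℕ, ℓ.Prime → ¬ ℓ ∣ 2 * M * W.conductorNorm ℤ → ‖Literature.NumberTheory.EllipticCurves.embCoeff g ι ℓ - (W.frobeniusTrace ℓ : PadicAlgCl 2)‖ < 1) → ∀ (κ : Literature.NumberTheory.EllipticCurves.ZpExtension ℚ 2) (γ : Field.absoluteGaloisGroup ℚ), κ.IsCyclotomic → κ.IsTopGenerator γ → Literature.NumberTheory.EllipticCurves.IsCyclotomicVariable 2 γ → ∀ (S₀ : Finset (IsDedekindDomain.HeightOneSpectrum (NumberField.RingOfIntegers ℚ))), (∀ v ∈ S₀, ((2 : ℕ) : NumberField.RingOfIntegers ℚ) ∉ v.asIdeal) → (∀ v : IsDedekindDomain.HeightOneSpectrum (NumberField.RingOfIntegers ℚ), ¬ W.HasGoodReductionAt v → v ∈ S₀) → (∀ v : IsDedekindDomain.HeightOneSpectrum (NumberField.RingOfIntegers ℚ), Rat.HeightOneSpectrum.natGenerator v ∣ M → v ∈ S₀) → ∀ (D : Literature.NumberTheory.EllipticCurves.Kobayashi2003.SignedSelmerDualData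 W κ γ 1) [Module.Finite (Literature.NumberTheory.EllipticCurves.IwasawaAlgebra 2) D.X], Module.IsTorsion (Literature.NumberTheory.EllipticCurves.IwasawaAlgebra 2) D.X → D.mu = 0 → ∀ (Lp Lm : Literature.NumberTheory.EllipticCurves.IwasawaAlgebraO (Set.range ι)) (d : ℕ), Literature.NumberTheory.EllipticCurves.IsPollackPairK g ι Ω Lp Lm → (∀ k : ℕ, ‖PowerSeries.coeff k (Literature.NumberTheory.EllipticCurves.iwasawaOToPowerSeries (Set.range ι) Lm)‖ ≤ ‖PowerSeries.coeff d (Literature.NumberTheory.EllipticCurves.iwasawaOToPowerSeries (Set.range ι) Lm)‖) → (∀ k : ℕ, k < d → ‖PowerSeries.coeff k (Literature.NumberTheory.EllipticCurves.iwasawaOToPowerSeries (Set.range ι) Lm)‖ < ‖PowerSeries.coeff d (Literature.NumberTheory.EllipticCurves.iwasawaOToPowerSeries (Set.range ι) Lm)‖) → d + (∑ v ∈ S₀, 2 ^ padicValNat 2 ((Rat.HeightOneSpectrum.natGenerator v ^ 2 - 1) / 8) * (if Rat.HeightOneSpectrum.natGenerator v ∣ M then (if ‖Literature.NumberTheory.EllipticCurves.embCoeff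 g ι (Rat.HeightOneSpectrum.natGenerator v) - 1‖ < 1 then 1 else 0) else (if ‖Literature.NumberTheory.EllipticCurves.embCoeff g ι (Rat.HeightOneSpectrum.natGenerator v)‖ < 1 then 2 else 0))) ≤ Literature.NumberTheory.EllipticCurves.lambdaInvariant 2 D.X + (∑ v ∈ S₀, 2 ^ padicValNat 2 ((Rat.HeightOneSpectrum.natGenerator v ^ 2 - 1) / 8) * Literature.NumberTheory.EllipticCurves.GreenbergVatsal2000.dMultiplicity W 2 v) := by
  sorry

/-- The crux BY NAME from the three stubs (p618059). -/
theorem ResidualThetaCountLowerPureAtTwo_of : Summit.BirchSwinnertonDyer.BirchSwinnertonDyer.Theses.ResidualThetaTransportAtTwo.ResidualThetaCountLowerPureAtTwo :=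
  Summit.BirchSwinnertonDyer.BirchSwinnertonDyer.Theorems.ResidualLayer.residualThetaCountLowerPureAtTwo_of_lambdaLowerPure
    stub_publishedInputsGreenbergControlAtTwo stub_rankEqAnalyticRankLeOne stub_lambdaLowerPure

end Summit.BirchSwinnertonDyer.BirchSwinnertonDyer.Cruxes.ResidualThetaCountLowerPureAtTwo.LambdaIneqFrame
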